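import Literature.Probability.RandomPlanarGeometry.CritPercSLESimplePath
import Literature.Probability.RandomPlanarGeometry.SLETwoPointFlowProofs
import Literature.Probability.RandomPlanarGeometry.SLEOnePointNonSwallowingProofs
import Literature.Probability.RandomPlanarGeometry.SLETraceCriterionProofs
import HarnessLib

/-!
# The simple phase `κ ≤ 4`: discharge glue for `sle_swallowingTime_ofReal_eq_top`

Topic `Probability/RandomPlanarGeometry`; theorems only (proof sibling of `CritPercSLESimplePath`).
The named fact `Literature.Probability.RandomPlanarGeometry.sle_swallowingTime_ofReal_eq_top`
(Lawler (2005), Prop. 6.8, first item: "If `κ ≤ 4`, then w.p.1 `T_x = ∞` for all `x > 0`") —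
the only input, besides trace existence, of the reduction
`ae_isSimpleTrace_sleTrace_of_le_four_of_facts` of Rohde–Schramm's Thm. 6.1 — is reduced here
to its **per-point form for `0 < κ ≤ 4`** ("for every `x > 0`, almost surely `T_x = ∞`", the
output of the optional-stopping argument of Lawler's Prop. 1.21 / Rohde–Schramm's Lemma 6.2,
applied point by point), by proving the two remaining steps of the printed proofs:

* *all points at once* (Lawler (2005), §1.10, p. 25: "If `x < y`, then `X_t^x < X_t^y` for all
  `t < T_x`; in particular `T_x ≤ T_y`"; Rohde–Schramm p. 901: "Observe that if `x' > x`, then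
  `Y_{x'}(t) ≥ Y_x(t)`. Therefore, a.s. for every `x > 0` …"): monotonicity of `T_x` in `x`
  (`Loewner.swallowingTime_mono_right`) and countably many null events
  (`Loewner.forall_swallowingTime_eq_top_of_seq`, `ae_forall_swallowingTime_eq_top_of_forall`);
* *the case `κ = 0`* (inside the range `κ ≤ 4` of the fact, Lawler's Def. 6.1 allowing `κ ≥ 0`):
  the zero driving function swallows no real point `x ≠ 0`, because the real flow `gₜ(x)` is
  monotone (`re_map_mono`) while a swallowed point reaches the driving function
  (`realFlow_lt_of_near_swallowingTime`): `Loewner.swallowingTime_zero_driving`.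

Assembled: `sle_swallowingTime_ofReal_eq_top_of_pointwise` and, with trace existence,
`ae_isSimpleTrace_sleTrace_of_le_four_of_pointwise`.

**Discharge.** The per-point form is proved in the tree (`ae_sle_swallowingTime_eq_top_of_le_four`,
`SLEOnePointNonSwallowingProofs`: the generator martingales of the real flow stopped at the exit
time of `(x₁, x₂)` and the bounds `P{X_{t∧σ} = x₁} ≤ (x₁/x)^{4/κ-1}`, resp. logarithmic, then
`x₁ → 0+`), so the named fact **holds**: `sle_swallowingTime_ofReal_eq_top_holds`. Consequently Rohde–Schramm's Thm. 6.1 rests on trace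
existence alone: for a given `κ ≤ 4`, `HasSLETrace κ` implies that the SLE_κ trace is a.s. simple
(`ae_isSimpleTrace_sleTrace_of_hasSLETrace`), and the target
`ae_isSimpleTrace_sleTrace_of_le_four` follows from the named fact `hasSLETrace_of_ne_eight`
(Rohde–Schramm Thm. 5.1; `ae_isSimpleTrace_sleTrace_of_le_four_of_hasSLETrace_fact`), i.e. from
Rohde–Schramm's Thm. 3.6 (`RohdeSchramm2005_thm36`, through `hasSLETrace_of_ne_eight_of_thm36`;
`ae_isSimpleTrace_sleTrace_of_le_four_of_thm36`).

## References

* G. F. Lawler, *Conformally Invariant Processes in the Plane*, AMS (2005): §1.10 (p. 25),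
  Prop. 1.21, Def. 6.1, Prop. 6.8, Ex. 4.11 (`gₜ(z) = √(z² + 4t)` for the zero driving function).
* S. Rohde, O. Schramm, *Basic properties of SLE*, Ann. of Math. 161 (2005), proof of Lemma 6.2
  (p. 901) and Thm. 6.1.
-/

noncomputable section

open Set Filter Topology MeasureTheory
open scoped NNReal

namespace Literature.Probability.RandomPlanarGeometry

namespace Loewner

/-- **The zero driving function swallows no positive real point**: for `W = 0` and `x > 0`,
`T_x = ⊤`. The real flow `gₜ(x)` is non-decreasing (`re_map_mono`), so `Xₜ = gₜ(x) - 0 ≥ x`,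
while a finite swallowing time forces `Xₜ → 0` (`realFlow_lt_of_near_swallowingTime`).
(Explicitly `gₜ(x) = √(x² + 4t)`, Lawler (2005), Ex. 4.11.) [folklore] -/
theorem swallowingTime_zero_driving_of_pos {x : ℝ} (hx : 0 < x) :
    swallowingTime (fun _ : ℝ≥0 ↦ (0 : ℝ)) x = ⊤ := by
  set W : ℝ≥0 → ℝ := fun _ ↦ 0 with hWdef
  have hW : Continuous W := continuous_const
  have hx0 : W 0 < x := hx
  by_contra hT
  obtain ⟨b, hb⟩ := WithTop.ne_top_iff_exists.1 hT
  obtain ⟨s, hsb, hs⟩ := realFlow_lt_of_near_swallowingTime hW hx0 hb.symm hx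
  have hsT : (s : WithTop ℝ≥0) < swallowingTime W x := by rw [← hb]; exact_mod_cast hsb
  have h1 : realFlow W x s < x := hs s le_rfl hsb
  have h2 : x ≤ realFlow W x s := by
    rw [realFlow_apply]
    have hmono := re_map_mono hW hx0 (zero_le (a := s)) hsT
    have hx' : (x : ℂ) ≠ W 0 := fun h ↦ hx0.ne' (by exact_mod_cast h)
    rw [map_zero_apply hW hx'] at hmono
    simpa [hWdef] using hmono
  exact absurd h1 (not_lt.2 h2)

/-- For `W = 0` and any real `x ≠ 0`, `T_x = ⊤` (negative points by the reflection
`swallowingTime_neg_ofReal`, `-0 = 0`). [folklore] -/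
theorem swallowingTime_zero_driving {x : ℝ} (hx : x ≠ 0) :
    swallowingTime (fun _ : ℝ≥0 ↦ (0 : ℝ)) x = ⊤ := by
  rcases lt_or_gt_of_ne hx with h | h
  · have := swallowingTime_zero_driving_of_pos (neg_pos.2 h)
    rw [← swallowingTime_neg_ofReal] at this
    simpa using this
  · exact swallowingTime_zero_driving_of_pos h

/-- **Per-point to all-points**: for a continuous driving function started at `0`, if
`T_{1/(n+1)} = ⊤` for every `n`, then `T_x = ⊤` for every `x > 0` (monotonicity of `T_x` in `x`,
`swallowingTime_mono_right`; Lawler (2005), §1.10: "in particular `T_x ≤ T_y`"). [folklore] -/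
theorem forall_swallowingTime_eq_top_of_seq {W : ℝ≥0 → ℝ} (hW : Continuous W) (hW0 : W 0 = 0)
    (h : ∀ n : ℕ, swallowingTime W ((1 / ((n : ℝ) + 1) : ℝ) : ℂ) = ⊤) {x : ℝ} (hx : 0 < x) :
    swallowingTime W x = ⊤ := by
  obtain ⟨n, hn⟩ := exists_nat_one_div_lt hx
  have hle : swallowingTime W ((1 / ((n : ℝ) + 1) : ℝ) : ℂ) ≤ swallowingTime W x :=
    swallowingTime_mono_right hW (by rw [hW0]; positivity) hn.le
  rw [h n] at hle
  exact top_le_iff.1 hle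

end Loewner

/-- **All points at once** for the SLE_κ driving function: if for every `x > 0`, almost surely
`T_x = ⊤`, then almost surely `T_x = ⊤` for every `x > 0` (countably many null events
`{T_{1/(n+1)} < ⊤}` and monotonicity in `x`; Rohde–Schramm (2005), proof of Lemma 6.2, p. 901:
"Observe that if `x' > x`, then `Y_{x'}(t) ≥ Y_x(t)`. Therefore, a.s. for every `x > 0` we
have `Y_x(t)` well defined and in `(0, ∞)` for all `t ≥ 0`"). [cite: RohdeSchramm2005, proof of Lemma 6.2 (p. 901)] -/
theorem ae_forall_swallowingTime_eq_top_of_forall {κ : ℝ≥0}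
    (h : ∀ x : ℝ, 0 < x →
      ∀ᵐ ω ∂Process.preWienerMeasure, Loewner.swallowingTime (sleDriving κ ω) x = ⊤) :
    ∀ᵐ ω ∂Process.preWienerMeasure, ∀ x : ℝ, 0 < x →
      Loewner.swallowingTime (sleDriving κ ω) x = ⊤ := by
  have hseq : ∀ᵐ ω ∂Process.preWienerMeasure, ∀ n : ℕ,
      Loewner.swallowingTime (sleDriving κ ω) ((1 / ((n : ℝ) + 1) : ℝ) : ℂ) = ⊤ :=
    ae_all_iff.2 fun n ↦ h _ (by positivity)
  filter_upwards [hseq] with ω hω x hx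
  exact Loewner.forall_swallowingTime_eq_top_of_seq (continuous_sleDriving κ ω) (sleDriving_zero κ ω)
    hω hx

/-- **The case `κ = 0`** of `sle_swallowingTime_ofReal_eq_top`: the driving function is `0`, and
the zero driving function swallows no real point `x ≠ 0` (`Loewner.swallowingTime_zero_driving`),
for every sample path. [folklore] -/
theorem ae_forall_swallowingTime_eq_top_zero :
    ∀ᵐ ω ∂Process.preWienerMeasure, ∀ x : ℝ, 0 < x →
      Loewner.swallowingTime (sleDriving 0 ω) x = ⊤ := by
  refine ae_of_all _ fun ω x hx ↦ ?_
  have hW : sleDriving 0 ω = fun _ ↦ (0 : ℝ) := by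
    funext t; simp [sleDriving_apply]
  rw [hW]
  exact Loewner.swallowingTime_zero_driving hx.ne'

/-- **`sle_swallowingTime_ofReal_eq_top` from its per-point form.** If for every `0 < κ ≤ 4` and
every `x > 0`, almost surely `T_x = ⊤` (Lawler (2005), Prop. 1.21 / Prop. 6.8 (i), proved by
optional stopping point by point), then for every `κ ≤ 4`, almost surely `T_x = ⊤` for all
`x > 0` simultaneously (`ae_forall_swallowingTime_eq_top_of_forall`); the case `κ = 0` is the zero
driving function (`ae_forall_swallowingTime_eq_top_zero`). [cite: Lawler2005, Prop. 6.8] -/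
theorem sle_swallowingTime_ofReal_eq_top_of_pointwise
    (h : ∀ {κ : ℝ≥0} {x : ℝ}, 0 < κ → κ ≤ 4 → 0 < x →
      ∀ᵐ ω ∂Process.preWienerMeasure, Loewner.swallowingTime (sleDriving κ ω) x = ⊤) :
    sle_swallowingTime_ofReal_eq_top := by
  intro κ hκ
  rcases (zero_le (a := κ)).eq_or_lt with h0 | h0
  · rw [← h0]
    exact ae_forall_swallowingTime_eq_top_zero
  · exact ae_forall_swallowingTime_eq_top_of_forall fun x hx ↦ h h0 hκ hx

/-- **Rohde–Schramm (2005), Thm. 6.1 from trace existence and the per-point non-swallowing of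
positive reals** (`0 < κ ≤ 4`, `x > 0` ⇒ a.s. `T_x = ⊤`): `ae_isSimpleTrace_sleTrace_of_le_four_of_facts`
fed with `sle_swallowingTime_ofReal_eq_top_of_pointwise`. [cite: RohdeSchramm2005, Thm 6.1] -/
theorem ae_isSimpleTrace_sleTrace_of_le_four_of_pointwise {κ : ℝ≥0} (h51 : hasSLETrace_of_ne_eight)
    (h : ∀ {κ : ℝ≥0} {x : ℝ}, 0 < κ → κ ≤ 4 → 0 < x →
      ∀ᵐ ω ∂Process.preWienerMeasure, Loewner.swallowingTime (sleDriving κ ω) x = ⊤) :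
    ae_isSimpleTrace_sleTrace_of_le_four (κ := κ) :=
  ae_isSimpleTrace_sleTrace_of_le_four_of_facts h51 (sle_swallowingTime_ofReal_eq_top_of_pointwise h)

/-! ### Discharge of the named fact and the final reductions of Thm. 6.1 -/

/-- **The named fact `sle_swallowingTime_ofReal_eq_top` holds** (Lawler (2005), Prop. 6.8, first
item: "If `κ ≤ 4`, then w.p.1 `T_x = ∞` for all `x > 0`"): the per-point statement for
`0 < κ ≤ 4` is `ae_sle_swallowingTime_eq_top_of_le_four` (`SLEOnePointNonSwallowingProofs`),
upgraded to all points at once and completed at `κ = 0` by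
`sle_swallowingTime_ofReal_eq_top_of_pointwise`. [cite: Lawler2005, Prop. 6.8] -/
theorem sle_swallowingTime_ofReal_eq_top_holds : sle_swallowingTime_ofReal_eq_top :=
  sle_swallowingTime_ofReal_eq_top_of_pointwise fun hκ0 hκ hx ↦
    ae_sle_swallowingTime_eq_top_of_le_four hκ0 hκ hx

/-- **Rohde–Schramm (2005), Thm. 6.1 for a given `κ ≤ 4` from trace existence at that `κ`**: if
SLE_κ is almost surely generated by a curve (`HasSLETrace κ`), then its trace is almost surely a
simple trace. The proof of `ae_isSimpleTrace_sleTrace_of_le_four_of_facts` with the now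
discharged non-swallowing fact (`sle_swallowingTime_ofReal_eq_top_holds`).
[cite: RohdeSchramm2005, Thm 6.1] -/
theorem ae_isSimpleTrace_sleTrace_of_hasSLETrace {κ : ℝ≥0} (hT : HasSLETrace κ) (hκ4 : κ ≤ 4) :
    ∀ᵐ ω ∂Process.preWienerMeasure, Loewner.IsSimpleTrace (sleTrace κ ω) := by
  have hreal : ∀ᵐ ω ∂Process.preWienerMeasure, ∀ q : ℚ, 0 < q → ∀ x : ℝ,
      x ≠ sleDriving κ ω ((q : ℝ).toNNReal) →
        Loewner.swallowingTime (fun u ↦ sleDriving κ ω ((q : ℝ).toNNReal + u)) x = ⊤ := by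
    rw [ae_all_iff]
    intro q
    filter_upwards [ae_forall_swallowingTime_shift_eq_top sle_swallowingTime_ofReal_eq_top_holds hκ4
      ((q : ℝ).toNNReal)] with ω hω _ x hx
    set c : ℝ := sleDriving κ ω ((q : ℝ).toNNReal) with hc
    have h1 := hω (x - c) (sub_ne_zero.2 hx)
    have key := Loewner.swallowingTime_add_const
      (fun u ↦ sleDriving κ ω ((q : ℝ).toNNReal + u) - c) ((x - c : ℝ) : ℂ) c
    simp only [sub_add_cancel] at key
    rw [h1] at key
    have hxc : (((x - c : ℝ) : ℂ) + (c : ℂ)) = (x : ℂ) := by push_cast; ring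
    rw [hxc] at key
    exact key
  filter_upwards [hT, hreal] with ω h1 h2
  exact Loewner.isSimpleTrace_trace_of_shift (continuous_sleDriving κ ω) h1 h2

/-- **The target `ae_isSimpleTrace_sleTrace_of_le_four` (Rohde–Schramm Thm. 6.1) from trace
existence alone**: granted the named fact `hasSLETrace_of_ne_eight` (Rohde–Schramm Thm. 5.1),
everything else is proved in `Literature`. [cite: RohdeSchramm2005, Thm 6.1] -/
theorem ae_isSimpleTrace_sleTrace_of_le_four_of_hasSLETrace_fact {κ : ℝ≥0}
    (h51 : hasSLETrace_of_ne_eight) : ae_isSimpleTrace_sleTrace_of_le_four (κ := κ) :=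
  ae_isSimpleTrace_sleTrace_of_le_four_of_facts h51 sle_swallowingTime_ofReal_eq_top_holds

/-- **The target from Rohde–Schramm's Thm. 3.6 alone**: `ae_isSimpleTrace_sleTrace_of_le_four`
follows from the stochastic estimate `RohdeSchramm2005_thm36` (a.s. `f̂ₜ(iy)` extends continuously
to `[0, ∞)²`), through `hasSLETrace_of_ne_eight_of_thm36` (Thm. 5.1 = Thm. 3.6 + the proved
Thm. 4.1). [cite: RohdeSchramm2005, Thm 6.1] -/
theorem ae_isSimpleTrace_sleTrace_of_le_four_of_thm36 {κ : ℝ≥0} (h36 : RohdeSchramm2005_thm36) :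
    ae_isSimpleTrace_sleTrace_of_le_four (κ := κ) :=
  ae_isSimpleTrace_sleTrace_of_le_four_of_hasSLETrace_fact (hasSLETrace_of_ne_eight_of_thm36 h36)

end Literature.Probability.RandomPlanarGeometry
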